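import Mathlib
import Summits.PneNP.PneNP.Theorems.ConvexRankGatesConvexGateBlindExactLiftingIndexRectangles
import Summits.PneNP.PneNP.Theorems.ConvexRankGatesConvexGateBlindExactLiftingK4

/-!
# PneNP / ConvexRankGates — `ConvexGateBlind`, line `xor-door-perfect-completeness`:
# the unit-potential level of `stub_exactLifting` with its exact exponent (lead c4)

Registered sub-goal `unitLevel_nmf_bound` of crux item stmt-PneNP-10680 (line
`xor-door-perfect-completeness`, open stub `stub_exactLifting : XorDoor.ExactLifting`).

`ExactLifting` asks, for a fixed unsatisfiable 3-XOR system `F` on `m` variables with a degree-`d`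
perfect pseudo-expectation, that every cone factorisation of the shifted Index-lift
`N_t - εJ = (viol_F(x[w]) - ε)_{x,w}` have size `≥ t^{φ(d)}` for ALL `ε > 0` beyond a threshold
`T(F)`; the rank corner gives this with exponent `1` (`…ExactLiftingRankCorner.lean`), the junta
factorisation gives `rk₊(N_t) ≤ #F · t³` at `ε = 0`, and every functional (hyperplane / corruption)
lower bound for `N_t - εJ` is capped by `rk₊(N_t) + ε · rk₊(N_t - J)`, so the first place where the
exponent can be SEEN to leave the rank corner is the unit-potential level `ε = 1`.  This file settles
that level, with the exact exponent, for the LP part: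

* `unitLevel_nmf_bound` (registered): for every `t ≥ 1`, every non-negative factorisation
  `viol_F(x[w]) - 1 = ∑_{l<r} U_{x,l} V_{l,w}` has `#{z : viol_F z ≥ 2} · t^κ ≤ r · 6^m` whenever
  `{viol_F ≥ 2}` contains no subcube of codimension `< κ` — i.e. `rk₊(N_t - J) ≥ c_F · t^{κ_F}`,
  `c_F = #{viol_F ≥ 2} / 6^m`.  Proof: the support of `N_t - J` is the lift of `{viol_F ≥ 2}`, which
  has `t^m · #{viol_F ≥ 2} · 2^{m(t-1)}` entries (`card_lift`), and the `r` support rectangles of the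
  factorisation obey the Index-lift rectangle lemma (`IndexRect.indexRect_nmf_bound`).
  `UnitLevel.coneFact_bound` is the same in the `HasConeFact · 0 r` vocabulary of the stub.
* The K₄ test instance (`K4` of `…ExactLiftingK4.lean`: the odd-charge Tseitin system of `K₄`, 6 edge
  variables, 4 vertex equations, the minimal `d = 3` instance of the line, `HasPerfectPseudoExp 3 K4`
  there): `{viol ≥ 2}` has exactly `32` points (`k4_card`) and contains NO subcube of codimension `< 5`
  (`k4_noSubcube`), hence `k4_unitLevel`: every non-negative
  factorisation of `lift_t(viol_{K4}) - J` has `32 · t⁵ ≤ 6⁶ · r`, i.e. `r ≥ t⁵ / 1458`, for every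
  `t ≥ 1` — exponent exactly `5 = deg_SA(K₄)` (the identity `viol - ε = (1-ε) + 2[s₁s₂] + 2[s₃(s₁⊕s₂)]`
  in the vertex parities `s_v` gives `rk₊(N_t - εJ) ≤ 1 + 2t⁵` for all `ε ≤ 1`), against
  `rk₊(N_t) ≤ 4t³`.  So on K₄ the exponent of `ε ↦ rk₊(N_t - εJ)` climbs from `3` to exactly `5` on
  `(0, 1]`; `stub_exactLifting` (for `d → ∞`) is the assertion that it has already left `3` at `ε = 0⁺`.
  `k4_unitLevel_window` records both sides (lower here, upper = `k4_unitLevel_upper` of the K4 file).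

Everything here is elementary counting on top of the rectangle lemma; no definitions.
-/

set_option linter.dupNamespace false -- `Summit.PneNP.PneNP.…`: summit = sub-problem (D-0017)

namespace Summit.PneNP.PneNP.Theorems.XorDoor

open scoped BigOperators
open Finset

noncomputable section

namespace UnitLevel

variable {m t : ℕ}

/-! ## §1 Counting the entries of a lift -/

/-- The fibre of the lookup map over a word `z` at a fixed pointer tuple has `(2^{t-1})^m` tables. -/
theorem card_lookup_fiber (w : Fin m → Fin t) (z : Fin m → ZMod 2) :
    (univ.filter fun x : Fin m → Fin t → ZMod 2 => IndexRect.lookup x w = z).card = (2 ^ (t - 1)) ^ m := by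
  classical
  have hset : (univ.filter fun x : Fin m → Fin t → ZMod 2 => IndexRect.lookup x w = z)
      = Fintype.piFinset fun i => univ.filter
          (fun row : Fin t → ZMod 2 => ∀ a ∈ ({w i} : Finset (Fin t)), row a = z i) := by
    ext x
    simp only [mem_filter, mem_univ, true_and, Fintype.mem_piFinset, Finset.mem_singleton,
      forall_eq]
    constructor
    · intro h i
      exact congrFun h i
    · intro h
      funext i
      exact h i
  rw [hset, Fintype.card_piFinset]
  have : ∀ i : Fin m, (univ.filter
      (fun row : Fin t → ZMod 2 => ∀ a ∈ ({w i} : Finset (Fin t)), row a = z i)).card = 2 ^ (t - 1) := by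
    intro i
    rw [IndexRect.card_const_on, Finset.card_singleton]
  simp only [this, Finset.prod_const, Finset.card_univ, Fintype.card_fin]

/-- The lift of a set `Zs` of words has `t^m · #Zs · (2^{t-1})^m` entries. -/
theorem card_lift (Zs : Finset (Fin m → ZMod 2)) :
    (univ.filter fun p : (Fin m → Fin t → ZMod 2) × (Fin m → Fin t) =>
        IndexRect.lookup p.1 p.2 ∈ Zs).card = t ^ m * (Zs.card * (2 ^ (t - 1)) ^ m) := by
  classical
  have hw : ∀ w : Fin m → Fin t,
      (univ.filter fun x : Fin m → Fin t → ZMod 2 => IndexRect.lookup x w ∈ Zs).card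
        = Zs.card * (2 ^ (t - 1)) ^ m := by
    intro w
    rw [Finset.card_eq_sum_card_fiberwise (f := fun x => IndexRect.lookup x w) (t := Zs)
      (fun x hx => by simpa using hx)]
    have : ∀ z ∈ Zs, ((univ.filter fun x : Fin m → Fin t → ZMod 2 => IndexRect.lookup x w ∈ Zs).filter
        fun x => IndexRect.lookup x w = z).card = (2 ^ (t - 1)) ^ m := by
      intro z hz
      rw [← card_lookup_fiber w z]
      congr 1
      ext x
      simp only [mem_filter, mem_univ, true_and, and_iff_right_iff_imp]
      intro h; rw [h]; exact hz
    rw [Finset.sum_congr rfl this, Finset.sum_const, smul_eq_mul]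
  rw [Finset.card_filter, Fintype.sum_prod_type, Finset.sum_comm]
  have : ∀ w : Fin m → Fin t, ∑ x : Fin m → Fin t → ZMod 2,
      (if IndexRect.lookup (x, w).1 (x, w).2 ∈ Zs then 1 else 0) = Zs.card * (2 ^ (t - 1)) ^ m := by
    intro w
    rw [← hw w, Finset.card_filter]
  rw [Finset.sum_congr rfl fun w _ => this w, Finset.sum_const, smul_eq_mul, Finset.card_univ,
    Fintype.card_fun, Fintype.card_fin, Fintype.card_fin]

/-! ## §2 The unit-potential level of the XOR lift -/

/-- **Registered sub-goal `unitLevel_nmf_bound` of stmt-PneNP-10680** (proved as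
`UnitLevel.nmf_bound`): the unit-potential (`ε = 1`) level of `stub_exactLifting`, LP part, with the
exact exponent.  If `{z : viol_F z ≥ 2}` contains no subcube of codimension `< κ`, then for every
`t ≥ 1` every non-negative factorisation `viol_F(x[w]) - 1 = ∑_{l<r} U_{x,l} V_{l,w}` of the Index-lift
minus the all-ones matrix has `#{viol_F ≥ 2} · t^κ ≤ r · 6^m`, i.e. `rk₊(lift_t(viol_F) - J) ≥ c_F · t^κ`. -/
theorem nmf_bound {κ r : ℕ} (F : Finset (Pool m)) (ht : 1 ≤ t)
    (hZ : IndexRect.NoSubcube {z : Fin m → ZMod 2 | 2 ≤ viol F z} κ)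
    (U : (Fin m → Fin t → ZMod 2) → Fin r → ℝ) (V : Fin r → (Fin m → Fin t) → ℝ)
    (hU : ∀ x l, 0 ≤ U x l) (hV : ∀ l w, 0 ≤ V l w)
    (hM : ∀ (x : Fin m → Fin t → ZMod 2) (w : Fin m → Fin t),
      (viol F (fun i => x i (w i)) : ℝ) - 1 = ∑ l, U x l * V l w) :
    (univ.filter fun z : Fin m → ZMod 2 => 2 ≤ viol F z).card * t ^ κ ≤ r * 6 ^ m := by
  classical
  obtain ⟨s, rfl⟩ : ∃ s, t = s + 1 := ⟨t - 1, by omega⟩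
  set Zs : Finset (Fin m → ZMod 2) := univ.filter fun z : Fin m → ZMod 2 => 2 ≤ viol F z with hZs
  let M : (Fin m → Fin (s + 1) → ZMod 2) → (Fin m → Fin (s + 1)) → ℝ :=
    fun x w => (viol F (IndexRect.lookup x w) : ℝ) - 1
  have hMdef : ∀ x w, M x w = ∑ l, U x l * V l w := fun x w => hM x w
  have hMnn : ∀ x w, 0 ≤ M x w := fun x w => by
    rw [hMdef]; exact Finset.sum_nonneg fun l _ => mul_nonneg (hU x l) (hV l w)
  have hsupp : ∀ x w, M x w ≠ 0 → IndexRect.lookup x w ∈ {z : Fin m → ZMod 2 | 2 ≤ viol F z} := by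
    intro x w hne
    have hpos : 0 < M x w := lt_of_le_of_ne (hMnn x w) (Ne.symm hne)
    have h1 : (1 : ℝ) < viol F (IndexRect.lookup x w) := by
      change 0 < (viol F (IndexRect.lookup x w) : ℝ) - 1 at hpos; linarith
    have h1' : 1 < viol F (IndexRect.lookup x w) := by exact_mod_cast h1
    exact h1'
  let P : Finset ((Fin m → Fin (s + 1) → ZMod 2) × (Fin m → Fin (s + 1))) :=
    univ.filter fun p => IndexRect.lookup p.1 p.2 ∈ Zs
  have hP : ∀ p ∈ P, 0 < M p.1 p.2 := by
    intro p hp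
    simp only [P, hZs, mem_filter, mem_univ, true_and] at hp
    change 0 < (viol F (IndexRect.lookup p.1 p.2) : ℝ) - 1
    have : (2 : ℝ) ≤ viol F (IndexRect.lookup p.1 p.2) := by exact_mod_cast hp
    linarith
  have hmain := IndexRect.indexRect_nmf_bound _ hZ M hsupp U V hU hV hMdef P hP
  have hPcard : P.card = (s + 1) ^ m * (Zs.card * (2 ^ s) ^ m) := by
    simpa using card_lift (t := s + 1) Zs
  rw [hPcard] at hmain
  -- cancel the common factor `(s+1)^m · (2^s)^m`
  have hpow : (2 : ℕ) ^ (m * (s + 1)) = 2 ^ m * (2 ^ s) ^ m := by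
    rw [pow_mul, ← mul_pow]; ring
  rw [hpow] at hmain
  have hc : 0 < (s + 1) ^ m * (2 ^ s) ^ m := by positivity
  refine Nat.le_of_mul_le_mul_right ?_ hc
  calc Zs.card * (s + 1) ^ κ * ((s + 1) ^ m * (2 ^ s) ^ m)
      = (s + 1) ^ m * (Zs.card * (2 ^ s) ^ m) * (s + 1) ^ κ := by ring
    _ ≤ r * (3 ^ m * ((s + 1) ^ m * (2 ^ m * (2 ^ s) ^ m))) := hmain
    _ = r * 6 ^ m * ((s + 1) ^ m * (2 ^ s) ^ m) := by
        rw [show (6 : ℕ) ^ m = 3 ^ m * 2 ^ m by rw [← mul_pow]; norm_num]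
        ring

/-- The same bound in the cone-factorisation vocabulary of the stub (`HasConeFact · 0 r` = LP part). -/
theorem coneFact_bound {κ r : ℕ} (F : Finset (Pool m)) (ht : 1 ≤ t)
    (hZ : IndexRect.NoSubcube {z : Fin m → ZMod 2 | 2 ≤ viol F z} κ)
    (h : HasConeFact (fun (x : Fin m → Fin t → ZMod 2) (w : Fin m → Fin t) =>
      (viol F (fun i => x i (w i)) : ℝ) - 1) 0 r) :
    (univ.filter fun z : Fin m → ZMod 2 => 2 ≤ viol F z).card * t ^ κ ≤ r * 6 ^ m := by
  obtain ⟨H, Y, U, V, -, -, hU, hV, hM⟩ := h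
  refine nmf_bound F ht hZ U V hU hV fun x w => ?_
  have := hM x w
  simpa [Matrix.trace] using this

/-! ## §3 The K₄ test instance: lower bound and the closed unit window -/

open K4Inst

/-- **The unit-potential level on K₄, exact exponent.**  For every `t ≥ 1`, every non-negative
factorisation of the Index-lift of `viol_{K4}` minus the all-ones matrix,
`viol_{K4}(x[w]) - 1 = ∑_{l<r} U_{x,l} V_{l,w}`, has `32 · t⁵ ≤ 6⁶ · r` (`r ≥ t⁵/1458`); together with
`rk₊ ≤ 1 + 2t⁵` from the degree-5 identity this pins `rk₊(lift_t(viol_{K4}) - J) = Θ(t⁵)`, while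
`rk₊(lift_t viol_{K4}) ≤ 4t³`. -/
theorem k4_unitLevel {t r : ℕ} (ht : 1 ≤ t)
    (U : (Fin 6 → Fin t → ZMod 2) → Fin r → ℝ) (V : Fin r → (Fin 6 → Fin t) → ℝ)
    (hU : ∀ x l, 0 ≤ U x l) (hV : ∀ l w, 0 ≤ V l w)
    (hM : ∀ (x : Fin 6 → Fin t → ZMod 2) (w : Fin 6 → Fin t),
      (viol K4 (fun i => x i (w i)) : ℝ) - 1 = ∑ l, U x l * V l w) :
    32 * t ^ 5 ≤ r * 6 ^ 6 := by
  have h := nmf_bound K4 ht k4_noSubcube U V hU hV hM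
  rwa [k4_card] at h

/-- **The unit-potential window of K₄ is closed at exponent `5`:** for every `t ≥ 1`, (lower) every
non-negative LP factorisation of `lift_t(viol_{K4}) − J` has `32 t⁵ ≤ 6⁶ r`, and (upper) one with
`r ≤ #{S : #S ≤ 5} (2t)⁵` exists. -/
theorem k4_unitLevel_window {t : ℕ} (ht : 1 ≤ t) :
    (∀ r : ℕ, HasConeFact (fun (x : Fin 6 → Fin t → ZMod 2) (w : Fin 6 → Fin t) =>
        (viol K4 (fun i => x i (w i)) : ℝ) - 1) 0 r → 32 * t ^ 5 ≤ r * 6 ^ 6) ∧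
    (∃ r : ℕ, r ≤ Fintype.card {S : Finset (Fin 6) // S.card ≤ 5} * (2 * t) ^ 5 ∧
      HasConeFact (fun (x : Fin 6 → Fin t → ZMod 2) (w : Fin 6 → Fin t) =>
        (viol K4 (fun i => x i (w i)) : ℝ) - 1) 0 r) := by
  refine ⟨fun r h => ?_, Summit.PneNP.PneNP.Theorems.XorDoor.k4_unitLevel_upper ht⟩
  have hb := coneFact_bound K4 ht k4_noSubcube h
  rwa [k4_card] at hb

end UnitLevel

/-- **Registered sub-goal `unitLevel_nmf_bound` of stmt-PneNP-10680** (by name): the unit-potential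
level of `stub_exactLifting`, LP part, exact exponent — if `{viol_F ≥ 2}` has no subcube of
codimension `< κ`, every non-negative factorisation of `(viol_F(x[w]) - 1)_{x,w}` with `r` terms
has `#{viol_F ≥ 2} · t^κ ≤ r · 6^m` (`t ≥ 1`). -/
theorem unitLevel_nmf_bound :
    ∀ (m t κ r : ℕ) (F : Finset (Pool m)), 1 ≤ t →
      IndexRect.NoSubcube {z : Fin m → ZMod 2 | 2 ≤ viol F z} κ →
      ∀ (U : (Fin m → Fin t → ZMod 2) → Fin r → ℝ) (V : Fin r → (Fin m → Fin t) → ℝ),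
        (∀ x l, 0 ≤ U x l) → (∀ l w, 0 ≤ V l w) →
        (∀ (x : Fin m → Fin t → ZMod 2) (w : Fin m → Fin t),
          (viol F (fun i => x i (w i)) : ℝ) - 1 = ∑ l, U x l * V l w) →
        (Finset.univ.filter fun z : Fin m → ZMod 2 => 2 ≤ viol F z).card * t ^ κ ≤ r * 6 ^ m :=
  fun _ _ _ _ F ht hZ U V hU hV hM => UnitLevel.nmf_bound F ht hZ U V hU hV hM

end

end Summit.PneNP.PneNP.Theorems.XorDoor
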